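import Summits.QuantumFields.GaugeBoot.Rows.GLYZc1D4Ent
import Summits.QuantumFields.GaugeBoot.Rows.GLYZc1D4Blocks
import Summits.QuantumFields.GaugeBoot.Eqs.GLYZc1D4RedY
import HarnessLib

/-!
# Gauge-boot: cross-check of the two transcriptions of eng2's glyz-c1-4D reduction files (lean1 `ycol`/`S`/`R` = lean2 `RedY`)

Cell `pub-gaugeboot` (HOME `run/shared/lean/pub/pub-gaugeboot/`), seat lean1. Referee nicety (lead A139 (1): not a gate):
the reduction matrices `Y_k` and the raw line lists of `pub-gaugeboot-num2/r1/glyzc1_D4/reduction_glyzc1_D4_{H,site1,link1}.json`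
were transcribed independently by lean1 (`GLYZc1D4Ent.ycol`, packed numerals; `GLYZc1D4Blocks.S`/`R`, digit codes) and by
lean2 (`Eqs/GLYZc1D4RedY`: `YH`/`YS`/`YK`, `linesH`/`linesS` as plain literals). The kernel checks here that they agree
entry by entry, so the reduction identity (`GLYZc1D4RedCheck*`, checked against lean1's copy) also holds for lean2's.

HONEST FRAMING (page 1 of every file of this cell): certified bounds on lattice expectations at STATED coupling,
gauge group, dimension and torus size; NOT a mass gap, NOT a continuum limit, NOT a string tension, NOT large `N`.
The venture is explicitly NOT Yang–Mills-summit-bearing (barriers `FixedCouplingUltralocality`,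
`PerturbativeInvisibility`).
-/

namespace Summit.QuantumFields.GaugeBoot

namespace GLYZc1D4

/-- **lean1's packed reduction columns = lean2's literal export**, all 34 blocks, all columns. -/
theorem ycol_eq_RedY : ∀ k : Fin 34, ∀ i < bdim k, ycol k i = ((Red.YH ++ Red.YS ++ Red.YK).getD k.val []).getD i [] := by
  decide +kernel

/-- **lean1's `H` lines = lean2's `linesH`.** -/
theorem S_eq_linesH : ∀ i : Fin 211, S i = Red.linesH.getD i.val [] := by decide +kernel

/-- **lean1's reflection-block lines = lean2's `linesS`** (= `linesK`). -/
theorem R_eq_linesS : ∀ i : Fin 144, R i = Red.linesS.getD i.val [] := by decide +kernel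

end GLYZc1D4

end Summit.QuantumFields.GaugeBoot
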